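import Literature.MathematicalPhysics.QuantumFieldTheory.Balaban1983to89.B6Line3CubeV1L0
import Literature.MathematicalPhysics.QuantumFieldTheory.Balaban1983to89.B6Prop26KLevelAssemblyPadV1L0
import HarnessLib
import Literature.MathematicalPhysics.QuantumFieldTheory.Balaban1983to89.B6Cover236MultiLevelBlocksL0
import Literature.MathematicalPhysics.QuantumFieldTheory.Balaban1983to89.B6CubeWindowV1L0
import Literature.MathematicalPhysics.QuantumFieldTheory.Balaban1983to89.B6Geom246MultiLevelTorusL0
import Literature.MathematicalPhysics.QuantumFieldTheory.Balaban1983to89.B6GlobalChartV1L0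
import Literature.MathematicalPhysics.QuantumFieldTheory.Balaban1983to89.B6MultiLevelTorusOperatorL0
import Literature.MathematicalPhysics.QuantumFieldTheory.Balaban1983to89.B6PadLevelV1L0
import Literature.MathematicalPhysics.QuantumFieldTheory.Balaban1983to89.B6Prop26KLevelSkeletonV1L0
import Literature.MathematicalPhysics.QuantumFieldTheory.Balaban1983to89.B8Ineq192MultiLevelTorusL0

/-!
# `Balaban1983to89.B6Line3CubePadV1L0` — LEVEL-0 TWIN (programme G-F3′-L0, director-ym LINE №27 / UV3-NODE §24.5; plan `lit-balaban-r03/G-F3L0-PLAN.md`) of `B6Line3CubePadV1`: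
the same declarations, SAME NAMES AND STATEMENTS, for nested families WITH print's region `Λ₀ = T ∖ Ω₁` ADMITTED (structures
`B6MultiLevelBoxOperatorL0.Domains` / `B6MultiLevelTorusOperatorL0.TDomains`: levels `0, …, k`, the level-`0` block a single site, `Q′₀ = id`,
finite weight `a₀` — print p.225 (2.14) «Σ_{j=0}^k … (Q′₀λ)(x) = λ(x), x ∈ Λ₀», p.229 «taking a sequence (2.1) … smallest possible domains B^j(Λ_j),
and considering the operator Δ_a defined by (2.19), (2.20) for this sequence»).  Every `D`-free object is the lineage's, consumed BY NAME; no existing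
module is touched; no fact is minted.  Unit `lit-balaban-p33` (p33 gen 101; programme RIGHT-ENTRY-L0 = the (2.136)₃ right-factor chain at level 0, the input of [B9] Thm 3.3's right entry (3.42)₃ for the bond-sector cube letter G_□(1), cell GAPS G-B9-02; port tooling by r03 gen 36–37); B6 fold owner r03; referee ref-4.  THE TWIN'S DOCUMENTATION FOLLOWS
VERBATIM (its «levels 1 … k» / «Ω₁ = X» sentences describe the twin; here `j` runs from `0` and `Ω₁` may be a proper subset).

# [B6] Prop. 2.6, line 3 of (2.92) FOR THE CUBE MEMBERS OF THE PADDED FAMILY `padT D` — the (iv) input of the `k`-level (2.136)₁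
# assemblies for EVERY ODD `L ≥ 5` (no placement hypothesis), as a lemma BY NAME

statement-level skeleton of published theorems with citation tags; proofs where landed; nothing here is a claim about the Yang–Mills mass gap

T. Bałaban, *Propagators and renormalization transformations for lattice gauge theories. II*, Commun. Math. Phys. **96** (1984) 223–250
[Balaban1984PropagatorsII]; journal page = PDF page + 222 (`paper:balaban1984-cmp96-propagators-rt-ii`): Proposition 2.6 (2.136) p. 247,
(2.92) p. 239 (line 3: *"+(ζ_□(∂P∂* − ∂P_□∂*)h_□A)_μ(x)"*), p. 224 (2.1)–(2.4) (*"we admit the case when some domains Ω_j are equal to T_η"*),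
(2.36) p. 229.

[tag: formalized_from_source] (assembly ours).  CITATION HEADER (lean-in-tree rule) — WHAT IS REPRODUCED.  Phase-2 file of the `lit-balaban` typed
skeleton (HOME `run/shared/lean/pub/lit-balaban/`), seat **p22 gen 22** (literature-prover-lit-balaban-p22-g22-0); SKELETON rows **B6.Prop2.6** ×
B6.Eq2.92 × B6.Eq2.134 (cells only; decls of record untouched; B6 fold owner r03, referee ref-4).  IMPORTS BY NAME, restating nothing:
r03's `…B6Line3CubeV1L0.line3_cube` (p366020: line 3 of (2.92) for the genuine member of every PLACED cube of a V1 torus family) and p38's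
padding `…B6PadLevelV1` (`padT D` — one more, empty, level, `P′ = L·P″` — whose cubes are ALL placed, `placed_pad`) with the V1 bookkeeping
`hLP_of_V1`/`hP5_of_V1`/`hk'_of_V1` of `…B6Prop26KLevelAssemblyPadV1`.  The route is the one named in `B6Line3CubeV1`'s header: *«for every odd
`L ≥ 5` without placement use p38's padded twin … fed with `line3_cube` at the padded family»*; the ASSEMBLIES that consume this input are NOT restated
here — they are p38's `…B6Prop26GradKLevelV1L0.prop26_2136_grad_kLevel_unconditional_pad_V1` ((2.136)₁ ∧ (2.136)₂, p367862) and r05's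
`…B8Prop3MultiLevelTorusP26L0.prop3_multiLevelTorus_V1_P26_free` ([B8] Prop. 3, p367786), each of which performs this instantiation inline; this file is
the by-name home of that step (r05 15:08Z: «the right B6-side home for the instantiation»).

## WHAT THIS FILE CERTIFIES (kernel-checked, 0 sorry, standard axioms; THEOREMS ONLY — no `def`, no `def … : Prop`, no new named fact)

* **`line3_cube_pad`** — LINE 3 OF (2.92) FOR THE CUBE MEMBERS OF THE PADDED FAMILY: `line3_cube` instantiated at
  `(hN_pad hN hLP, padT D hLP, hk'_of_V1 hN hMha hP)` with `hLP := hLP_of_V1 hN hMha hP` (`P″ = P′/L`), `2 ≤ k + 1` from `1 ≤ k`, every cube placed by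
  `placed_pad`, weights `w ∘ (sameOm_domT_pad …).idxB`.  Its conclusion is VERBATIM the (iv) binder of `prop26_2136_kLevel_final_pad_M_V1` and of
  r05's `…B8Prop3MultiLevelTorusP26L0.prop3_multiLevelTorus_V1_P26_pad_M`, at the rate `ρ₃` of `line3_cube`; **`line3_cube_pad_le`** — the same at any
  rate `r ≤ ρ₃` (monotonicity of the majorant), so a consumer working at `2σ ≤ ρ₃` applies it in one line.

## HONEST SCOPE / DIVERGENCES

(1) Everything analytic is r03's (`line3_cube`) and p38's (the padding); this file is the bookkeeping that puts them together, nothing more.  (2) The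
hypotheses are print's SETTING: (2.2) `M` large (`M₃ ≤ L·M_h`, `M_h = L^a ≥ 8`), `R ≥ 2L²`; the V1 torus with `k ≥ 1`, `P′_μ ≥ 5L` (in the V1 setting
`P′ = 2L^n`, so this is `P′ ≥ 6L`: the torus is as large as needed — print lets `T_η` be arbitrary), `L ≥ 5` odd (`L = 3` would need the re-centred
window of `B6CubeInDecayV1`, r03's honest scope).  (3) The constants `ρ₃, C_D, c_D, M₃` are those of `line3_cube` (functions of `d, L, b₀, b₁`).
(4) Distance (2.46) in p21's reading R2; integer torus, lattice units; nothing on `d = 4` specifically or on the continuum; NOT summit progress.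
Unit `lit-balaban-p22` (gen 22), 2026-08-23.
-/

noncomputable section

open scoped BigOperators
open Finset

namespace Literature.MathematicalPhysics.QuantumFieldTheory.Balaban1983to89.B6Line3CubePadV1L0

open B4Reflection242 (boxDom)
open B6MultiLevelBoxOperator (N0)
open B6MultiLevelTorusOperatorL0 (TDomains)
open B6Cover236MultiLevelBlocksL0 (cubes)
open B6Geom246MultiLevelTorusL0 (geomT)
open B8Ineq192MultiLevelTorusL0 (geomTB)
open B6RandomWalk (HasMajorant hasMajorant_mono)
open B6Prop26Gluing (mulOp)
open B6Ineq2133TwoScaleV1 (onFun)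
open B6GlobalChartV1 (PV)
open B6GlobalChartV1L0 (domT blkV1)
open B6SectAOperatorsV1 (dE dsE RE BondIdx)
open B6Prop26KLevelSkeletonV1L0 (hB zB)
open B6CubeWindowV1 (band_le one_le_of_eight_le four_le_of_five_le)
open B6CubeWindowV1L0 (Pl)
open B6PadLevelV1 (hN_pad SameOm.idxB)
open B6PadLevelV1L0 (padT placed_pad sameOm_domT_pad)
open B6Prop26KLevelAssemblyPadV1 (hLP_of_V1 hP5_of_V1 hk'_of_V1)
open B6Line3CubeV1L0 (line3_cube)

variable {d ℓ : ℕ} {hd : 1 ≤ d + 1} {hL : Odd (ℓ + 1) ∧ 1 < ℓ + 1}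

/-! ## §1  Line 3 of (2.92) for the cube members of the padded family -/

section Line3Pad

open Classical in
/-- **LINE 3 OF (2.92) FOR THE GENUINE MEMBER OF EVERY CUBE OF THE PADDED FAMILY `padT D`** (all cubes placed: `placed_pad`) — r03's `line3_cube`
at `(hN_pad hN hLP, padT D hLP, hk'_of_V1)`, `hLP := hLP_of_V1 hN hMha hP`; stated on the ORIGINAL data (`hN`, `D`, `hk`, `k ≥ 1`, `M_h = L^a ≥ 8`,
`R ≥ 2L²`, `P′ ≥ 5L`, `ℓ ≥ 4`, `M₃ ≤ L·M_h`, `c_f ≠ 0`, any weights `w`), conclusion = verbatim the (iv) binder of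
`B6Prop26KLevelAssemblyPadV1L0.prop26_2136_kLevel_final_pad_M_V1`, at rate `ρ₃`.
[cite: Balaban1984PropagatorsII, (2.92) p.239 (line 3), (2.134) p.247, (2.1)–(2.4) p.224, (2.36) p.229; assembly ours] -/
theorem line3_cube_pad (d ℓ : ℕ) (hd : 1 ≤ d + 1) (hL : Odd (ℓ + 1) ∧ 1 < ℓ + 1) {b₀ b₁ : ℝ} (hb₀ : 0 < b₀) (hb₁ : b₀ ≤ b₁) :
    ∃ ρ₃ CD cD M₃ : ℝ, 0 < ρ₃ ∧ 0 ≤ CD ∧ 0 < cD ∧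
    ∀ (m K : ℕ) {Mh k R : ℕ} {P' : Fin (d + 1) → ℕ}
      (hN : ∀ μ, N0 ℓ Mh k P' μ = (PV d ℓ m K hd hL).sitesPerDir 0) (D : B6MultiLevelTorusOperatorL0.TDomains d ℓ Mh k P' R) (hk : k ≤ m + K) (_ : 1 ≤ k)
      {a : ℕ} (hMha : Mh = (ℓ + 1) ^ a) (hM8 : 8 ≤ Mh) (_ : 2 * (ℓ + 1) ^ 2 ≤ R) (hP : ∀ μ, 5 * (ℓ + 1) ≤ P' μ) (_ : 4 ≤ ℓ)
      (_ : M₃ ≤ ((ℓ : ℝ) + 1) * Mh)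
      {cf : ℝ} (_ : cf ≠ 0) (w : BondIdx (domT hN D hk) → ℝ) (c : ↥(cubes (padT D (hLP_of_V1 hN hMha hP)).toDomains)),
      HasMajorant (g := geomTB (padT D (hLP_of_V1 hN hMha hP))) (blkV1 (hN_pad hN (hLP_of_V1 hN hMha hP)) (padT D (hLP_of_V1 hN hMha hP)))
        (mulOp (zB (hN_pad hN (hLP_of_V1 hN hMha hP)) (padT D (hLP_of_V1 hN hMha hP)) (one_le_of_eight_le hM8)
            (four_le_of_five_le (hP5_of_V1 hP)) c) *
          (onFun (dE (P := PV d ℓ m K hd hL) cf ∘ₗ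
              (LinearMap.id - RE (domT (hN_pad hN (hLP_of_V1 hN hMha hP)) (padT D (hLP_of_V1 hN hMha hP)) (hk'_of_V1 hN hMha hP)) cf) ∘ₗ dsE cf) -
            Pl (hN_pad hN (hLP_of_V1 hN hMha hP)) (hk'_of_V1 hN hMha hP) (one_le_of_eight_le hM8) (four_le_of_five_le (hP5_of_V1 hP)) hMha c
              (band_le (d := d) (ℓ := ℓ) hb₀ hb₁) (placed_pad D (hLP_of_V1 hN hMha hP) (hP5_of_V1 hP) c)
              (w ∘ (sameOm_domT_pad hN D hk (hLP_of_V1 hN hMha hP) (hk'_of_V1 hN hMha hP)).idxB) cf) *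
          mulOp (hB (hN_pad hN (hLP_of_V1 hN hMha hP)) (padT D (hLP_of_V1 hN hMha hP)) c))
        (fun y y'' => CD * cf ^ 2 * Real.exp (-(cD * (geomTB (padT D (hLP_of_V1 hN hMha hP))).M)) /
          (geomTB (padT D (hLP_of_V1 hN hMha hP))).len y ^ 2 * Real.exp (-(ρ₃ * (geomTB (padT D (hLP_of_V1 hN hMha hP))).dist y y''))) := by
  obtain ⟨ρ₃, CD, cD, M₃, hρ₃, hCD, hcD, hcube⟩ := line3_cube d ℓ hd hL hb₀ hb₁
  refine ⟨ρ₃, CD, cD, M₃, hρ₃, hCD, hcD, ?_⟩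
  intro m K Mh k R P' hN D hk hk1 a hMha hM8 hR2 hP hℓ hM cf hcf w c
  exact hcube m K (hN_pad hN (hLP_of_V1 hN hMha hP)) (padT D (hLP_of_V1 hN hMha hP)) (hk'_of_V1 hN hMha hP) (by omega) hMha hM8 hR2
    (hP5_of_V1 hP) hℓ (fun c' => placed_pad D (hLP_of_V1 hN hMha hP) (hP5_of_V1 hP) c') hM hcf
    (w ∘ (sameOm_domT_pad hN D hk (hLP_of_V1 hN hMha hP) (hk'_of_V1 hN hMha hP)).idxB) c

open Classical in
/-- **THE SAME AT ANY RATE `r ≤ ρ₃`** (the majorant kernel is monotone in the rate), in particular at `2σ` for `σ ≤ ρ₃/2` — the shape a consumer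
(p38's `prop26_2136_kLevel_final_pad_M_V1` / `…GradKLevelV1…_pad_le_V1`, r05's `prop3_multiLevelTorus_V1_P26_pad_M`) quantifies over.
[cite: Balaban1984PropagatorsII, (2.92) p.239 (line 3), (2.134) p.247, (2.36) p.229; assembly ours] -/
theorem line3_cube_pad_le (d ℓ : ℕ) (hd : 1 ≤ d + 1) (hL : Odd (ℓ + 1) ∧ 1 < ℓ + 1) {b₀ b₁ : ℝ} (hb₀ : 0 < b₀) (hb₁ : b₀ ≤ b₁) :
    ∃ ρ₃ CD cD M₃ : ℝ, 0 < ρ₃ ∧ 0 ≤ CD ∧ 0 < cD ∧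
    ∀ (r : ℝ), r ≤ ρ₃ →
    ∀ (m K : ℕ) {Mh k R : ℕ} {P' : Fin (d + 1) → ℕ}
      (hN : ∀ μ, N0 ℓ Mh k P' μ = (PV d ℓ m K hd hL).sitesPerDir 0) (D : B6MultiLevelTorusOperatorL0.TDomains d ℓ Mh k P' R) (hk : k ≤ m + K) (_ : 1 ≤ k)
      {a : ℕ} (hMha : Mh = (ℓ + 1) ^ a) (hM8 : 8 ≤ Mh) (_ : 2 * (ℓ + 1) ^ 2 ≤ R) (hP : ∀ μ, 5 * (ℓ + 1) ≤ P' μ) (_ : 4 ≤ ℓ)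
      (_ : M₃ ≤ ((ℓ : ℝ) + 1) * Mh)
      {cf : ℝ} (_ : cf ≠ 0) (w : BondIdx (domT hN D hk) → ℝ) (c : ↥(cubes (padT D (hLP_of_V1 hN hMha hP)).toDomains)),
      HasMajorant (g := geomTB (padT D (hLP_of_V1 hN hMha hP))) (blkV1 (hN_pad hN (hLP_of_V1 hN hMha hP)) (padT D (hLP_of_V1 hN hMha hP)))
        (mulOp (zB (hN_pad hN (hLP_of_V1 hN hMha hP)) (padT D (hLP_of_V1 hN hMha hP)) (one_le_of_eight_le hM8)
            (four_le_of_five_le (hP5_of_V1 hP)) c) *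
          (onFun (dE (P := PV d ℓ m K hd hL) cf ∘ₗ
              (LinearMap.id - RE (domT (hN_pad hN (hLP_of_V1 hN hMha hP)) (padT D (hLP_of_V1 hN hMha hP)) (hk'_of_V1 hN hMha hP)) cf) ∘ₗ dsE cf) -
            Pl (hN_pad hN (hLP_of_V1 hN hMha hP)) (hk'_of_V1 hN hMha hP) (one_le_of_eight_le hM8) (four_le_of_five_le (hP5_of_V1 hP)) hMha c
              (band_le (d := d) (ℓ := ℓ) hb₀ hb₁) (placed_pad D (hLP_of_V1 hN hMha hP) (hP5_of_V1 hP) c)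
              (w ∘ (sameOm_domT_pad hN D hk (hLP_of_V1 hN hMha hP) (hk'_of_V1 hN hMha hP)).idxB) cf) *
          mulOp (hB (hN_pad hN (hLP_of_V1 hN hMha hP)) (padT D (hLP_of_V1 hN hMha hP)) c))
        (fun y y'' => CD * cf ^ 2 * Real.exp (-(cD * (geomTB (padT D (hLP_of_V1 hN hMha hP))).M)) /
          (geomTB (padT D (hLP_of_V1 hN hMha hP))).len y ^ 2 * Real.exp (-(r * (geomTB (padT D (hLP_of_V1 hN hMha hP))).dist y y''))) := by
  obtain ⟨ρ₃, CD, cD, M₃, hρ₃, hCD, hcD, hcube⟩ := line3_cube_pad d ℓ hd hL hb₀ hb₁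
  refine ⟨ρ₃, CD, cD, M₃, hρ₃, hCD, hcD, ?_⟩
  intro r hr m K Mh k R P' hN D hk hk1 a hMha hM8 hR2 hP hℓ hM cf hcf w c
  refine hasMajorant_mono (g := geomTB (padT D (hLP_of_V1 hN hMha hP))) (blkV1 (hN_pad hN (hLP_of_V1 hN hMha hP)) (padT D (hLP_of_V1 hN hMha hP)))
    (hcube m K hN D hk hk1 hMha hM8 hR2 hP hℓ hM hcf w c) ?_
  intro y y''
  have hd0 : 0 ≤ (geomTB (padT D (hLP_of_V1 hN hMha hP))).dist y y'' := Nat.cast_nonneg _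
  refine mul_le_mul_of_nonneg_left (Real.exp_le_exp.2 (by nlinarith)) ?_
  have := B6Prop26KLevelAssemblyV1L0.lenTB_pos (D := padT D (hLP_of_V1 hN hMha hP)) y
  positivity

end Line3Pad

end Literature.MathematicalPhysics.QuantumFieldTheory.Balaban1983to89.B6Line3CubePadV1L0
end
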